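import Summits.BirchSwinnertonDyer.Rank1Residual.P2.CongruentNumberSilentEvenFiveThetaDescent
import Summits.BirchSwinnertonDyer.Rank1Residual.P2.CongruentNumberSilentEvenFiveProofBHook
import Summits.BirchSwinnertonDyer.Rank1Residual.P2.CongruentNumberSilentEvenFiveSelmerEight
import HarnessLib

/-!
# Cell «bsd-monsky» (prover-B): route B's kernel with NEITHER the GZK binder NOR the Monsky 1990 binder —
# the `θ`-descent gives `𝓛(N) ≠ 0` and (with the displayed Thm 3.5) a rational point of infinite order; `#Sel₂ ≤ 8`
# gives rank `≤ 1`; C-P2-1 (both forms) on `𝒮⁻` from {`thetaGenusPointDatum`, Rédei–Reichardt, `hMe` | `#Sel₂ ≤ 8`}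

HONEST FRAMING (cell `bsd-monsky`, run/shared/lean/pub/bsd-monsky/; README §1: ONE theorem on ONE explicit
infinite family of quadratic twists of the congruent number curve at the prime `2`; not "BSD for rank ≤ 1",
nothing at odd primes, nothing booked until the cross-family referee passes the written proof). Every theorem
here is CONDITIONAL on named hypotheses; the two conjecture `Prop`s of C-P2-1 stay `@[conjecture]`.

WHAT THIS FILE ADDS to `P2/CongruentNumberSilentEvenFiveThetaDescent.lean` (THEOREM B in the kernel,
`odd_scriptL_of_thetaSpec_of_rank`: `g(N)` odd ⟹ `𝓛(N)` odd, modulo the display `thetaSpec` and a rank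
input "`𝓛(N) ≠ 0 ⟹ rank E_N(ℚ) ≤ 1`", there taken from GZK or from Monsky 1990 Cor 5.15). The observation
(PROOF-B §8 read once more): the contradiction of Theorem B is reached from "`(θ−1)P(N) ∈ ℤτ(i/2)`" ALONE,
and that membership holds as soon as `P(N)` is a torsion point of `A(ℍ′_N)` (Lemma 3.18: `A(ℍ′_N)_tor =
A[4]` for even `N`, and (θ2): `(θ−1)A[4] ⊆ ℤτ(i/2)`). Hence, with NO rank input at all:

WHAT "NO GZK BINDER" MEANS (honest framing): `GenusPointData.thm35Main` transcribes TYZ Thm 3.5 AS PRINTED — its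
`α_n` PRESUPPOSES rank one when `𝓛(n) ≠ 0` (GZK) and its printed proof uses the explicit Gross–Zagier formula
(Thm 3.3); the display carries the presupposition as a hypothesis on `α`, and §4 uses the clause in the
counterfactual rank-`0` case (generator trivial; literal print asserts `P(n)` torsion). So this file shortens the
enclosure's LIST OF NAMED HYPOTHESES (no `hGZK`, no `h515` = Monsky 1990 on any path); it does NOT make route B's
printed dependency graph Gross–Zagier-free (PROOF-B §11: TYZ Thm 3.3 is the shared printed input of both routes).

* §1 `theta_sub_P_ne_zsmul_tauIHalf`: `(θ−1)P(N) ∉ ℤτ(i/2)` (recursion side: `(θ−1)P(N) = g(N)·w + mτ(1)`,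
  `g(N)` odd, `2w ∈ {0, τ(1)}`, `θw + w = τ(1)`, `θτ(i/2) = −τ(i/2)`);
* §2 `not_isOfFinAddOrder_P`: the point `P(N) ∈ A(ℍ′_N)` has INFINITE ORDER;
* §3 `scriptL_ne_zero_of_thetaSpec`: `𝓛(N) ≠ 0` (Thm 3.5, main clause: `𝓛(n) = 0 ⟹ P(n)` torsion), hence
  clause (a) `ord_{s=1} L(E_N, s) = 1` (`analyticRank_eq_one_of_thetaSpec`: root number + TYZ's definition of
  `𝓛`) from the display and `g(N)` odd ONLY — no GZK, no Selmer count, no Monsky 1990;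
* §4 `mordellWeilRank_ne_zero_of_thetaSpec`: rank `E_N(ℚ) ≥ 1` with no GZK BINDER: were the rank `0`, the
  `2`-isogenous `A_N′(ℚ)` would be finite, the twist transfer `Θ_A : A_N′(ℚ) ↠ A(K_N)⁻` (W2, `stub_twist`)
  would make `A(K_N)⁻` torsion, so the torsion point `Θ_A(α₀)` "generates the free part" and the displayed
  Thm 3.5 relation `2^{ρ+1}P(N) − s𝓛(N)Θ_A(α₀) ∈ tor` would make `P(N)` torsion — contradicting §2;
* §5 with a `2`-Selmer bound `#Sel₂(E_N) ≤ 8` (descent count ⟹ rank `≤ 1`, prover-A's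
  `mordellWeilRank_le_one_of_card_selmerGroup_two_le_eight`): THEOREM B with NO GZK and NO Monsky 1990 binder
  (`odd_scriptL_of_thetaSpec_of_card_selmerGroup_two_le_eight`), and then rank EXACTLY one, `#Sel₂ = 8`,
  `Ш(E_N)[2^∞] = 0`, `𝓛(N)` odd (`rank_eq_one_sha_odd_scriptL_of_thetaSpec_of_le_eight` — Monsky's Cor 5.15 (2′)
  + Remark (2) on the `θ`-decidable pairs RE-DERIVED by route B); the bound is supplied on `𝒮⁻` by Monsky's EVEN
  matrix counted in the kernel (`card_selmerGroup_two_two_mul_five_mul (hMe)`, appendix to Heath-Brown 1994 —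
  the Selmer input PROOF-B §9 itself uses) or taken as the in-house hypothesis `hSel` (an explicit `2`-descent:
  PROOF-A App. D; in print Lagrange 1975 §11, Aoki 1999 Thm 2.1/4.1);
* §6 THE DOORS from three named inputs {`thetaGenusPointDatum` (`hΘ`), Rédei–Reichardt (`hR`), `hMe`} (and the
  `hSel` twins): `congruentSilentEvenFiveOrdTwo_of_thetaGenusPointDatum_of_monskyEven` (sharper form),
  `congruentSilentEvenFiveBSDTwo_of_thetaGenusPointDatum_of_monskyEven` (observable form:
  `ord_{s=1} L(E_{2pq}, s) = 1 ∧ BSD(E_{2pq}, 2)` on all of `𝒮⁻`) — route B's kernel enclosure now carries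
  neither the Monsky 1990 binder nor the GZK binder (the referee's independence caveat on the `_of_cor515`
  path, HOME/lean/ROUTE-B-ENCLOSURE.md, does not apply to this fact set), and clause (a) alone from {`hΘ`, `hR`}.

Nothing booked; no mark moved. The display `thetaGenusPointDatum` (reduced in the tree to `thetaCMDatum`,
(D1)–(D7)) remains the ONE obligation node of route B.

References: HOME/proof/PROOF-B.md (v1.3) §8–§9; [TianYuanZhang2017] §3.1 (p0011 L27–L36, L67–L73), Thm. 3.5 (p0011
L94–L112), Lemma 3.18 (p0017 L152–L153); [HeathBrown1994SelmerCongruentII] §1, Appendix (Monsky) p. 41; [SilvermanAEC2009]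
Thm. X.4.2, VIII.6.7, III.6.1–6.2; [Miller2011LMS] Def. 1.1; [LiMa2008] Thm. 0.4 (Rédei); [KoblitzECMF1993] Ch. II §5.
-/

noncomputable section

open scoped Classical

open WeierstrassCurve WeierstrassCurve.Affine NumberField Literature.NumberTheory.EllipticCurves
  Literature.NumberTheory.EllipticCurves.Rank1Residual
  Literature.NumberTheory.EllipticCurves.Rank1Residual.Typed
  Literature.NumberTheory.EllipticCurves.Monsky1990
  Literature.NumberTheory.EllipticCurves.HeathBrown1994
  Literature.NumberTheory.EllipticCurves.TianYuanZhang2017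
  Literature.NumberTheory.EllipticCurves.TianYuanZhang2017.W2
  Literature.NumberTheory.QuadraticFields.RedeiReichardt

set_option autoImplicit false

namespace Summit.BirchSwinnertonDyer.Rank1Residual.P2

open ThetaDescent Conjectures

namespace ThetaDescent

/-! ## §1 The core of Theorem B isolated: `(θ − 1)P(N) ∉ ℤτ(i/2)` -/

/-- **`(θ−1)P(N) ∉ ℤτ(i/2)`** for `N = 2pq`, `p ≡ 5 (mod 8)`, `q ≡ 3 (mod 4)`, `g(N)` odd, under the display
(`D.recursion`, `D.epsSpec`, `thetaSpec D θ`): the recursion side gives `(θ−1)P(N) = g(N)·w + mτ(1)` with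
`2w ∈ {0, τ(1)}` and `θw + w = τ(1)` (`theta_sub_P_eq`); if this were `Kτ(i/2)` then, `g(N)` being odd and
`τ(1) = 2τ(i/2)`, `w ∈ ℤτ(i/2)`, so `θw + w = 0` (`θτ(i/2) = −τ(i/2)`), contradicting `τ(1) ≠ 0`. This is the
second half of `odd_scriptL_of_thetaSpec_of_rank`, verbatim, with the torsion side abstracted into `K`.
[cite: TianYuanZhang2017, §3.1 (p0011 L67–L73), Thm. 3.6 (p0012 L22–L36)] -/
theorem theta_sub_P_ne_zsmul_tauIHalf {p q : ℕ} (hp : p.Prime) (hq : q.Prime) (hp5 : p % 8 = 5)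
    (hq4 : q % 4 = 3) (D : GenusPointData (2 * (p * q))) (hrec : D.recursion) (heps : D.epsSpec)
    (θ : D.H ≃ₐ[ℚ] D.H) (hθ : thetaSpec D θ) (hg : Odd (gK (2 * (p * q)))) (K : ℤ) :
    thetaPt D θ (D.P (2 * (p * q))) - D.P (2 * (p * q)) ≠ K • D.tauIHalf := by
  intro hK
  have hθ' := hθ
  obtain ⟨-, hθi, -, -, -, -, -⟩ := hθ'
  have h2τ : (2 : ℤ) • D.tauIHalf = (tauOne : APoint D.H) := by
    rw [two_zsmul, ← two_nsmul]; exact (tau_facts D).2.2.1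
  -- the recursion side: `(θ−1)P(N) = g•w + m'•τ(1)`
  obtain ⟨w, m', hw2, hww, hrecθ⟩ := theta_sub_P_eq hp hq hp5 hq4 D hrec heps θ hθ
  rw [hK] at hrecθ
  -- `w ∈ ℤτ(i/2)`
  obtain ⟨r, hr⟩ := hg
  have h2w : ∃ j : ℤ, (2 : ℕ) • w = j • D.tauIHalf := by
    rcases hw2 with h0 | h0
    · exact ⟨0, by rw [h0, zero_smul]⟩
    · exact ⟨2, by rw [h0, h2τ]⟩
  obtain ⟨j, hj⟩ := h2w
  have hw : w = (K - m' * 2 - (r : ℤ) * j) • D.tauIHalf := by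
    have e3 : (gK (2 * (p * q)) : ℤ) • w = K • D.tauIHalf - m' • tauOne :=
      eq_sub_of_add_eq hrecθ.symm
    have e4 : w = (gK (2 * (p * q)) : ℤ) • w - (r : ℤ) • ((2 : ℕ) • w) := by
      rw [hr]; push_cast; module
    calc w = (gK (2 * (p * q)) : ℤ) • w - (r : ℤ) • ((2 : ℕ) • w) := e4
      _ = (K • D.tauIHalf - m' • tauOne) - (r : ℤ) • (j • D.tauIHalf) := by rw [e3, hj]
      _ = (K • D.tauIHalf - m' • ((2 : ℤ) • D.tauIHalf)) - (r : ℤ) • (j • D.tauIHalf) := by rw [h2τ]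
      _ = (K - m' * 2 - (r : ℤ) * j) • D.tauIHalf := by module
  -- `θw + w = 0`, contradiction with `θw + w = τ(1) ≠ 0`
  have h0 : thetaPt D θ w + w = 0 := by
    rw [hw, map_zsmul, thetaPt_tauIHalf D θ hθi, smul_neg, neg_add_cancel]
  rw [h0] at hww
  exact tauOne_ne_zero hww.symm

/-! ## §2 `P(N)` has infinite order -/

/-- **The point `P(N) ∈ A(ℍ′_N)` has INFINITE ORDER** (`N = 2pq` as above, `g(N)` odd, display + `θ`-package):
a torsion `P(N)` lies in `A[4]` (Lemma 3.18, `N` even: `A(ℍ′_N)_tor` is killed by `4`), so `(θ−1)P(N) ∈ ℤτ(i/2)`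
by (θ2) — excluded by §1. No rank input, no `𝓛`. [cite: TianYuanZhang2017, Lemma 3.18 (p0017 L152–L153), §3.1 (p0011 L67–L73)] -/
theorem not_isOfFinAddOrder_P {p q : ℕ} (hp : p.Prime) (hq : q.Prime) (hp5 : p % 8 = 5) (hq4 : q % 4 = 3)
    (D : GenusPointData (2 * (p * q))) (hD : D.Printed) (θ : D.H ≃ₐ[ℚ] D.H) (hθ : thetaSpec D θ)
    (hg : Odd (gK (2 * (p * q)))) : ¬ IsOfFinAddOrder (D.P (2 * (p * q))) := by
  intro htor
  have hN6 : (2 * (p * q)) % 8 = 6 := by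
    have : (p * q) % 4 = 3 := by rw [Nat.mul_mod, show p % 4 = 1 by omega, hq4]
    omega
  obtain ⟨-, heps, hrec, -, -, -, -, -, h318, -, -⟩ := hD
  have hθ' := hθ
  obtain ⟨-, -, hA4, -, -, -, -⟩ := hθ'
  have h4 : (4 : ℕ) • D.P (2 * (p * q)) = 0 :=
    (h318.2 (Nat.even_iff.mpr (by omega))).1 _ htor
  obtain ⟨k, hk⟩ := hA4 _ h4
  exact theta_sub_P_ne_zsmul_tauIHalf hp hq hp5 hq4 D hrec heps θ hθ hg k hk

/-! ## §3 `𝓛(N) ≠ 0` and clause (a) `ord_{s=1} L(E_N, s) = 1` — from the display and `g(N)` odd only -/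

/-- **`𝓛(N) ≠ 0` with NO rank input**: Thm 3.5 (main clause, displayed with `ρ`) says `𝓛(n) = 0 ⟹ P(n)` is
torsion; `ρ(N)` exists (`stub_S3`); §2. [cite: TianYuanZhang2017, Thm. 3.5 (p0011 L94–L95) with §3.1 (p0011 L27–L36)] -/
theorem scriptL_ne_zero_of_thetaSpec {p q : ℕ} (hp : p.Prime) (hq : q.Prime) (hp5 : p % 8 = 5)
    (hq4 : q % 4 = 3) (D : GenusPointData (2 * (p * q))) (hD : D.Printed) (θ : D.H ≃ₐ[ℚ] D.H)
    (hθ : thetaSpec D θ) (hg : Odd (gK (2 * (p * q)))) : D.scriptL (2 * (p * q)) ≠ 0 := by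
  intro hL0
  have hsq : Squarefree (2 * (p * q)) := (isCor515Family_two_mul_five_mul' hp hq hp5 hq4).squarefree
  letI := isElliptic_congruentNumberCurve hsq.ne_zero
  have hn : 2 * (p * q) ∈ (2 * (p * q)).divisors := Nat.mem_divisors_self _ hsq.ne_zero
  obtain ⟨ρ, hρ⟩ := stub_S3 hsq
  have h35 : D.thm35Main := hD.2.2.2.2.1
  exact not_isOfFinAddOrder_P hp hq hp5 hq4 D hD θ hθ hg ((h35 hn ρ hρ).1 hL0)

/-- **Clause (a) from route B's display alone: `ord_{s=1} L(E_{2pq}, s) = 1`** (`g(2pq)` odd; no GZK, no Selmer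
count, no Monsky 1990): `𝓛(N) ≠ 0` (§3) is an integer with `𝓛(N)² = L′(E_N,1)/(4Ω R)` in analytic rank one and
`0` otherwise (TYZ's definition), and `L(E_N, 1) = 0` (root number `−1`, `N ≡ 6 (mod 8)`):
`analyticRank_congruentNumberCurve_eq_one_of_isScriptL`. [cite: TianYuanZhang2017, §1 (definition of 𝓛(n), p0002 L46–L75)]
[cite: KoblitzECMF1993, Ch. II §5, Theorem (p. 84)] -/
theorem analyticRank_eq_one_of_thetaSpec {p q : ℕ} (hp : p.Prime) (hq : q.Prime) (hp5 : p % 8 = 5)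
    (hq4 : q % 4 = 3) (D : GenusPointData (2 * (p * q))) (hD : D.Printed) (θ : D.H ≃ₐ[ℚ] D.H)
    (hθ : thetaSpec D θ) (hg : Odd (gK (2 * (p * q)))) :
    (congruentNumberCurve (2 * (p * q))).analyticRank = 1 := by
  have hN := isCor515Family_two_mul_five_mul' hp hq hp5 hq4
  have hn1 : 1 < 2 * (p * q) := by have := Nat.mul_pos hp.pos hq.pos; omega
  exact analyticRank_congruentNumberCurve_eq_one_of_isScriptL hN.squarefree hN.mod_eight
    (hD.1 _ (Nat.mem_divisors_self _ hN.ne_zero) hn1) (scriptL_ne_zero_of_thetaSpec hp hq hp5 hq4 D hD θ hθ hg)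

/-! ## §4 Rank `E_N(ℚ) ≥ 1` with no GZK binder -/

/-- **Rank `E_N(ℚ) ≠ 0` from the display, with no GZK binder**: if the rank were `0`, the `2`-isogenous curve
`A_N′(ℚ)` would have rank `0` (`Isogeny.mordellWeilRank_eq`), hence finitely many points (Mordell–Weil), so the
generator `α₀` of `A_N′(ℚ)` modulo torsion (`stub_S0'`) is torsion and `Θ_A(α₀)` — which generates the free part
of `A(K_N)⁻` (`generatesFreePart_of_twist`, `Θ_A` onto the minus part) — is torsion; Thm 3.5's relation
`2^{ρ+1}P(N) − s𝓛(N)·Θ_A(α₀) ∈ A(ℍ′_N)_tor` (`𝓛(N) ≠ 0`, §3) then makes `2^{ρ+1}P(N)`, hence `P(N)`, torsion —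
contradicting §2. HONEST FRAMING: in rank `0` a generator exists trivially, so no GZK BINDER is needed to use the
displayed clause; the print itself presupposes GZK and proves Thm 3.5 with the Gross–Zagier formula (module
docstring). [cite: TianYuanZhang2017, Thm. 3.5 (p0011 L94–L112), §3.1 (p0011 L27–L36)]
[cite: SilvermanAEC2009, Thm. VIII.6.7, Thm. III.6.2] -/
theorem mordellWeilRank_ne_zero_of_thetaSpec {p q : ℕ} (hp : p.Prime) (hq : q.Prime) (hp5 : p % 8 = 5)
    (hq4 : q % 4 = 3) (D : GenusPointData (2 * (p * q))) (hD : D.Printed) (θ : D.H ≃ₐ[ℚ] D.H)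
    (hθ : thetaSpec D θ) (hg : Odd (gK (2 * (p * q)))) :
    (congruentNumberCurve (2 * (p * q))).mordellWeilRank ≠ 0 := by
  intro h0
  have hsq : Squarefree (2 * (p * q)) := (isCor515Family_two_mul_five_mul' hp hq hp5 hq4).squarefree
  letI := isElliptic_congruentNumberCurve hsq.ne_zero
  have hn : 2 * (p * q) ∈ (2 * (p * q)).divisors := Nat.mem_divisors_self _ hsq.ne_zero
  have h35 : D.thm35Main := hD.2.2.2.2.1
  obtain ⟨ρ, hρ⟩ := stub_S3 hsq
  have hL0 := scriptL_ne_zero_of_thetaSpec hp hq hp5 hq4 D hD θ hθ hg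
  obtain ⟨ΘA, -, hΘAmem, hΘAsurj, -, -, -, -⟩ := stub_twist hsq hn
  -- the generator of `A_N′(ℚ)` modulo torsion is itself torsion in rank `0`
  have hr : (congruentNumberCurve (2 * (p * q))).mordellWeilRank ≤ 1 := by rw [h0]; exact zero_le_one
  obtain ⟨α₀, hα₀⟩ := stub_S0' hr
  have hA0 : (Atwo (2 * (p * q))).mordellWeilRank = 0 := by
    rw [← (congruentNumberCurve (2 * (p * q))).twoIsogeny.mordellWeilRank_eq]; exact h0
  haveI : Finite (Atwo (2 * (p * q))).toAffine.Point := finite_point_of_rank_zero _ hA0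
  have hα₀tor : IsOfFinAddOrder α₀ := isOfFinAddOrder_of_finite α₀
  -- Thm 3.5's relation with the torsion "generator" `Θ_A α₀`
  obtain ⟨s, -, hF1⟩ := (h35 hn ρ hρ).2 hL0 (ΘA α₀) (generatesFreePart_of_twist ΘA hΘAmem hΘAsurj hα₀)
  have hgen : IsOfFinAddOrder ((s * D.scriptL (2 * (p * q))) •
      Point.map (W' := curveA) (D.embK (2 * (p * q)) hn) (ΘA α₀)) :=
    ((Point.map (W' := curveA) (D.embK (2 * (p * q)) hn)).isOfFinAddOrder
      (ΘA.isOfFinAddOrder hα₀tor)).zsmul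
  have h2P : IsOfFinAddOrder (((2 : ℤ) ^ (ρ + 1)) • D.P (2 * (p * q))) := by
    have := hF1.add hgen
    rwa [sub_add_cancel] at this
  have h2P' : IsOfFinAddOrder ((2 ^ (ρ + 1) : ℕ) • D.P (2 * (p * q))) := by
    rw [← natCast_zsmul]; push_cast; exact h2P
  exact not_isOfFinAddOrder_P hp hq hp5 hq4 D hD θ hθ hg
    (W2.Abstract.isOfFinAddOrder_of_nsmul (pow_ne_zero _ two_ne_zero) h2P')

/-! ## §5 With a `2`-Selmer bound `#Sel₂ ≤ 8`: THEOREM B with no GZK / no Monsky 1990; rank EXACTLY one -/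

/-- **THEOREM B in the kernel, rank input from a `2`-Selmer bound**: for primes `p ≡ 5 (mod 8)`, `q ≡ 3 (mod 4)`,
TYZ data `D` with `D.Printed`, `θ` with `thetaSpec D θ`, `g(2pq)` odd and `#Sel₂(E_{2pq}) ≤ 8` (descent count
⟹ rank `≤ 1`, `mordellWeilRank_le_one_of_card_selmerGroup_two_le_eight`), the sign choice `D.scriptL (2pq)` of
`𝓛(2pq)` is ODD. NO GZK binder, NO Monsky 1990 binder — the fact set of PROOF-B §8–§9 itself.
[cite: SilvermanAEC2009, Thm. X.4.2] [cite: TianYuanZhang2017, Thm. 3.5 (p0011 L94–L112)] -/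
theorem odd_scriptL_of_thetaSpec_of_card_selmerGroup_two_le_eight {p q : ℕ} (hp : p.Prime) (hq : q.Prime)
    (hp5 : p % 8 = 5) (hq4 : q % 4 = 3) (D : GenusPointData (2 * (p * q))) (hD : D.Printed)
    (θ : D.H ≃ₐ[ℚ] D.H) (hθ : thetaSpec D θ) (hg : Odd (gK (2 * (p * q))))
    (hsel : Nat.card ((congruentNumberCurve (2 * (p * q))).selmerGroup 2) ≤ 8) :
    Odd (D.scriptL (2 * (p * q))) := by
  have hN := isCor515Family_two_mul_five_mul' hp hq hp5 hq4
  haveI := isElliptic_congruentNumberCurve hN.ne_zero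
  exact odd_scriptL_of_thetaSpec_of_rank hp hq hp5 hq4 D hD
    (fun _ => mordellWeilRank_le_one_of_card_selmerGroup_two_le_eight hN.ne_zero hsel) θ hθ hg

/-- **Monsky's Cor 5.15 (2′) + Remark (2) on the `θ`-decidable pairs, RE-DERIVED by route B**: for primes
`p ≡ 5 (mod 8)`, `q ≡ 3 (mod 4)` with `g(2pq)` odd, under the display and a bound `#Sel₂(E_{2pq}) ≤ 8`: rank
`E_{2pq}(ℚ) = 1` EXACTLY (`≥ 1` from §4 — no GZK; `≤ 1` from the bound), `#Sel₂(E_{2pq}) = 8` and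
`Ш(E_{2pq})[2^∞] = 0` (descent count `#Sel₂ = 2^{rank}·#E(ℚ)[2]·#Ш[2]` with `#E(ℚ)[2] = 4`:
`8 ≥ #Sel₂ = 8·#Ш[2]`), and `𝓛(2pq)` odd. CONDITIONAL; nothing asserted.
[cite: SilvermanAEC2009, Thm. X.4.2, Thm. VIII.6.7]
[cite: Monsky1990MockHeegner, Cor. 5.15 (2′) (p. 66), Remark (2) (p. 67) — the statement re-derived, not used] -/
theorem rank_eq_one_sha_odd_scriptL_of_thetaSpec_of_le_eight {p q : ℕ} (hp : p.Prime) (hq : q.Prime)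
    (hp5 : p % 8 = 5) (hq4 : q % 4 = 3) (D : GenusPointData (2 * (p * q))) (hD : D.Printed)
    (θ : D.H ≃ₐ[ℚ] D.H) (hθ : thetaSpec D θ) (hg : Odd (gK (2 * (p * q))))
    (hsel : Nat.card ((congruentNumberCurve (2 * (p * q))).selmerGroup 2) ≤ 8) :
    haveI := isElliptic_congruentNumberCurve
      (Nat.mul_ne_zero two_ne_zero (Nat.mul_ne_zero hp.ne_zero hq.ne_zero))
    (congruentNumberCurve (2 * (p * q))).mordellWeilRank = 1 ∧
      Nat.card ((congruentNumberCurve (2 * (p * q))).selmerGroup 2) = 8 ∧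
      AddCommGroup.primaryComponent (congruentNumberCurve (2 * (p * q))).sha 2 = ⊥ ∧
      Odd (D.scriptL (2 * (p * q))) := by
  have hN0 : 2 * (p * q) ≠ 0 := Nat.mul_ne_zero two_ne_zero (Nat.mul_ne_zero hp.ne_zero hq.ne_zero)
  haveI := isElliptic_congruentNumberCurve hN0
  haveI : Fact (Nat.Prime 2) := ⟨Nat.prime_two⟩
  have hrank : (congruentNumberCurve (2 * (p * q))).mordellWeilRank = 1 :=
    le_antisymm (mordellWeilRank_le_one_of_card_selmerGroup_two_le_eight hN0 hsel)
      (Nat.one_le_iff_ne_zero.mpr (mordellWeilRank_ne_zero_of_thetaSpec hp hq hp5 hq4 D hD θ hθ hg))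
  -- the descent count in rank one: `#Sel₂ = 2 · 4 · #(Ш ⊓ H¹[2]) ≤ 8` forces `#Sel₂ = 8`
  have hsel' : Nat.card ((congruentNumberCurve (2 * (p * q))).selmerGroup ((2 : ℕ) : ℤ)) ≤ 8 := by
    simpa only [Nat.cast_ofNat] using hsel
  haveI : Finite ((congruentNumberCurve (2 * (p * q))).selmerGroup ((2 : ℕ) : ℤ)) :=
    (congruentNumberCurve (2 * (p * q))).finite_selmerGroup_holds (by norm_num)
  have hpos : 0 < Nat.card ((congruentNumberCurve (2 * (p * q))).selmerGroup ((2 : ℕ) : ℤ)) := Nat.card_pos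
  have hcard := (congruentNumberCurve (2 * (p * q))).natCard_selmerGroup_eq (n := 2) two_ne_zero
  rw [hrank, pow_one] at hcard
  have aux : ∀ {C T S : ℕ}, C = 2 * T * S → T = 4 → 0 < C → C ≤ 8 → C = 8 := by
    intro C T S hTS hT hC0 hC8
    subst hT
    omega
  have h8 : Nat.card ((congruentNumberCurve (2 * (p * q))).selmerGroup ((2 : ℕ) : ℤ)) = 8 :=
    aux hcard (by convert Smith2016.natCard_torsionBy_two_congruentNumberCurve hN0; norm_num) hpos hsel'
  have h8' : Nat.card ((congruentNumberCurve (2 * (p * q))).selmerGroup 2) = 8 := by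
    simpa only [Nat.cast_ofNat] using h8
  exact ⟨hrank, h8', primaryComponent_sha_two_eq_bot_of_card_selmerGroup_eq_eight hN0 hrank h8',
    odd_scriptL_of_thetaSpec_of_card_selmerGroup_two_le_eight hp hq hp5 hq4 D hD θ hθ hg hsel⟩

end ThetaDescent

open ThetaDescent

/-! ## §6 THE DOORS from three named inputs {`thetaGenusPointDatum`, Rédei–Reichardt, `hMe` | `hSel`} — no GZK, no Monsky 1990 -/

/-- **Clause (a) on `𝒮⁻` from TWO named inputs {display, Rédei–Reichardt}: `ord_{s=1} L(E_{2pq}, s) = 1`** for all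
primes `p ≡ 5 (mod 8)`, `q ≡ 3 (mod 4)`, `(p/q) = −1` (`g(2pq)` odd by the tree's Rédei computation, `hR`). No GZK,
no Selmer count, no Monsky 1990. CONDITIONAL; nothing asserted. [cite: TianYuanZhang2017, §1 (definition of 𝓛(n), p0002 L46–L75), Thm. 3.5]
[cite: LiMa2008, Thm. 0.4 with Lemma 0.1] -/
theorem analyticRank_eq_one_sMinus_of_thetaGenusPointDatum
    (hΘ : ∀ p q : ℕ, p.Prime → q.Prime → p % 8 = 5 → q % 4 = 3 → thetaGenusPointDatum p q)
    (hR : redeiReichardt_fourTwoCard_classGroup) {p q : ℕ} (hp : p.Prime) (hq : q.Prime) (hp5 : p % 8 = 5)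
    (hq4 : q % 4 = 3) (hj : jacobiSym p q = -1) :
    (congruentNumberCurve (2 * (p * q))).analyticRank = 1 := by
  obtain ⟨D, hD, θ, hθ⟩ := hΘ p q hp hq hp5 hq4
  exact analyticRank_eq_one_of_thetaSpec hp hq hp5 hq4 D hD θ hθ
    (odd_genusClassNumber_genusField_two_mul_five_mul_of_jacobiSym_neg hR hp hq hp5 hq4 hj)

/-- **Route B on `𝒮⁻` with an in-house `2`-Selmer bound** (`hSel` : `#Sel₂(E_{2pq}) ≤ 8` on `𝒮⁻`, an explicit
`2`-descent) **⟹ the `𝒮⁻` output shape «`𝓛(2pq)` odd»** (`∃ L` odd, `IsScriptL (2pq) L`), from the display and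
Rédei–Reichardt; no GZK, no Monsky 1990, no `hMe`. CONDITIONAL; nothing asserted.
[cite: TianYuanZhang2017, Thm. 3.5 and §3] [cite: LiMa2008, Thm. 0.4] [cite: SilvermanAEC2009, Thm. X.4.2] -/
theorem odd_scriptL_sMinus_of_thetaGenusPointDatum_of_selmer_le_eight
    (hΘ : ∀ p q : ℕ, p.Prime → q.Prime → p % 8 = 5 → q % 4 = 3 → thetaGenusPointDatum p q)
    (hR : redeiReichardt_fourTwoCard_classGroup)
    (hSel : ∀ p q : ℕ, p.Prime → q.Prime → p % 8 = 5 → q % 4 = 3 → jacobiSym p q = -1 →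
      Nat.card ((congruentNumberCurve (2 * (p * q))).selmerGroup 2) ≤ 8) :
    ∀ p q : ℕ, p.Prime → q.Prime → p % 8 = 5 → q % 4 = 3 → jacobiSym p q = -1 →
      ∃ L : ℤ, Odd L ∧ IsScriptL (2 * (p * q)) L := by
  intro p q hp hq hp5 hq4 hj
  obtain ⟨D, hD, θ, hθ⟩ := hΘ p q hp hq hp5 hq4
  have hN0 : 2 * (p * q) ≠ 0 := Nat.mul_ne_zero two_ne_zero (Nat.mul_ne_zero hp.ne_zero hq.ne_zero)
  have hn1 : 1 < 2 * (p * q) := by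
    have := Nat.mul_pos hp.pos hq.pos; omega
  refine ⟨D.scriptL (2 * (p * q)), odd_scriptL_of_thetaSpec_of_card_selmerGroup_two_le_eight hp hq hp5 hq4
    D hD θ hθ (odd_genusClassNumber_genusField_two_mul_five_mul_of_jacobiSym_neg hR hp hq hp5 hq4 hj)
    (hSel p q hp hq hp5 hq4 hj), ?_⟩
  exact hD.1 _ (Nat.mem_divisors_self _ hN0) hn1

/-- **Route B ⟹ C-P2-1, sharper (`Ш_an`-unit) form, from {display, Rédei–Reichardt, `hSel`}** (`hSel` = the bound
`#Sel₂ ≤ 8` on `𝒮⁻`) — no GZK, no Monsky 1990: through the hook's `congruentSilentEvenFiveOrdTwo_of_odd_scriptL`.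
CONDITIONAL; nothing asserted. [cite: TianYuanZhang2017, §1 ((1.1)), Thm. 3.5] [cite: Miller2011LMS, Def. 1.1 (arXiv:1010.2431 p. 3)] -/
theorem congruentSilentEvenFiveOrdTwo_of_thetaGenusPointDatum_of_selmer_le_eight
    (hΘ : ∀ p q : ℕ, p.Prime → q.Prime → p % 8 = 5 → q % 4 = 3 → thetaGenusPointDatum p q)
    (hR : redeiReichardt_fourTwoCard_classGroup)
    (hSel : ∀ p q : ℕ, p.Prime → q.Prime → p % 8 = 5 → q % 4 = 3 → jacobiSym p q = -1 →
      Nat.card ((congruentNumberCurve (2 * (p * q))).selmerGroup 2) ≤ 8) :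
    CongruentSilentEvenFiveOrdTwo :=
  congruentSilentEvenFiveOrdTwo_of_odd_scriptL
    (odd_scriptL_sMinus_of_thetaGenusPointDatum_of_selmer_le_eight hΘ hR hSel)

/-- **Route B ⟹ C-P2-1, OBSERVABLE form (`ord_{s=1} L(E_{2pq}, s) = 1 ∧ BSD(E_{2pq}, 2)` on all of `𝒮⁻`) from
{display, Rédei–Reichardt, `hSel`}** — no GZK, no Monsky 1990: per member, rank `1` and `Ш[2^∞] = 0` by §5 and the
fact-free door D-CN-5 (`bsdp_two_congruentNumberCurve_iff_of_rank_one_of_sha_two_eq_bot`, `∏c_ℓ = 2⁶`,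
`#E(ℚ)_tors = 4`, `ord₂ x = 2`). CONDITIONAL; nothing asserted. [cite: Miller2011LMS, Def. 1.1 (arXiv:1010.2431 p. 3)]
[cite: SilvermanAEC2009, Thm. X.4.2] [cite: KoblitzECMF1993, Ch. II §5, Theorem (p. 84)] -/
theorem congruentSilentEvenFiveBSDTwo_of_thetaGenusPointDatum_of_selmer_le_eight
    (hΘ : ∀ p q : ℕ, p.Prime → q.Prime → p % 8 = 5 → q % 4 = 3 → thetaGenusPointDatum p q)
    (hR : redeiReichardt_fourTwoCard_classGroup)
    (hSel : ∀ p q : ℕ, p.Prime → q.Prime → p % 8 = 5 → q % 4 = 3 → jacobiSym p q = -1 →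
      Nat.card ((congruentNumberCurve (2 * (p * q))).selmerGroup 2) ≤ 8) :
    CongruentSilentEvenFiveBSDTwo := by
  intro p q hp hq hp5 hq4 hj
  obtain ⟨hN, hp2, hq2, hne⟩ := isCor515Family_two_mul_five_mul hp hq hp5 hq4
  haveI : Fact (Nat.Prime 2) := ⟨Nat.prime_two⟩
  obtain ⟨x, hx0, hx, hv⟩ :=
    congruentSilentEvenFiveOrdTwo_of_thetaGenusPointDatum_of_selmer_le_eight hΘ hR hSel p q hp hq hp5 hq4 hj
  obtain ⟨-, htam⟩ := twoExponent_tamagawa_two_mul_prime_mul hp hq hp2 hq2 hne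
  obtain ⟨D, hD, θ, hθ⟩ := hΘ p q hp hq hp5 hq4
  obtain ⟨hr, -, hbot, -⟩ := rank_eq_one_sha_odd_scriptL_of_thetaSpec_of_le_eight hp hq hp5 hq4 D hD θ hθ
    (odd_genusClassNumber_genusField_two_mul_five_mul_of_jacobiSym_neg hR hp hq hp5 hq4 hj)
    (hSel p q hp hq hp5 hq4 hj)
  obtain ⟨hr1, hiff⟩ := bsdp_two_congruentNumberCurve_iff_of_rank_one_of_sha_two_eq_bot hN hr hbot
    (torsionOrder_congruentNumberCurve hN.squarefree) hx0 hx
  refine ⟨hr1, hiff.mpr ?_⟩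
  rw [hv, htam, padicValNat.prime_pow]
  norm_num

/-- **THEOREM B on `𝒮⁻` in tree currency from the display and `hMe`** (Monsky's EVEN matrix counted in the kernel
on `𝒮⁻`: `#Sel₂(E_{2pq}) = 8`, `card_selmerGroup_two_two_mul_five_mul`; no GZK, no Monsky 1990): on `𝒮⁻`,
`∃ L` odd with `IsScriptL (2pq) L` — the hypothesis `hB` of the hook's `congruentSilentEvenFiveOrdTwo_of_odd_scriptL`.
CONDITIONAL on the display; nothing asserted. [cite: TianYuanZhang2017, Thm. 3.5 and §3]
[cite: HeathBrown1994SelmerCongruentII, §1 (typescript p. 1 L14–L20), Appendix (Monsky) p. 41 L20–L36] -/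
theorem odd_scriptL_sMinus_of_thetaGenusPointDatum_of_monskyEven
    (hΘ : ∀ p q : ℕ, p.Prime → q.Prime → p % 8 = 5 → q % 4 = 3 → thetaGenusPointDatum p q)
    (hR : redeiReichardt_fourTwoCard_classGroup) (hMe : monsky_card_selmerGroup_two_even) :
    ∀ p q : ℕ, p.Prime → q.Prime → p % 8 = 5 → q % 4 = 3 → jacobiSym p q = -1 →
      ∃ L : ℤ, Odd L ∧ IsScriptL (2 * (p * q)) L :=
  odd_scriptL_sMinus_of_thetaGenusPointDatum_of_selmer_le_eight hΘ hR
    (fun _ _ hp hq hp5 hq4 hj => (card_selmerGroup_two_two_mul_five_mul hMe hp hq hp5 hq4 hj).le)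

/-- **Route B ⟹ C-P2-1, sharper (`Ш_an`-unit) form, from {display, Rédei–Reichardt, `hMe`}** — no GZK, no Monsky
1990. CONDITIONAL; nothing asserted. [cite: TianYuanZhang2017, §1 ((1.1)), Thm. 3.5]
[cite: HeathBrown1994SelmerCongruentII, Appendix (Monsky) p. 41 L20–L36] [cite: Miller2011LMS, Def. 1.1 (arXiv:1010.2431 p. 3)] -/
theorem congruentSilentEvenFiveOrdTwo_of_thetaGenusPointDatum_of_monskyEven
    (hΘ : ∀ p q : ℕ, p.Prime → q.Prime → p % 8 = 5 → q % 4 = 3 → thetaGenusPointDatum p q)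
    (hR : redeiReichardt_fourTwoCard_classGroup) (hMe : monsky_card_selmerGroup_two_even) :
    CongruentSilentEvenFiveOrdTwo :=
  congruentSilentEvenFiveOrdTwo_of_odd_scriptL (odd_scriptL_sMinus_of_thetaGenusPointDatum_of_monskyEven hΘ hR hMe)

/-- **Route B ⟹ C-P2-1, OBSERVABLE form (`ord_{s=1} L(E_{2pq}, s) = 1 ∧ BSD(E_{2pq}, 2)` on all of `𝒮⁻`) from
THREE named inputs {`thetaGenusPointDatum`, Rédei–Reichardt, `hMe`} — NO GZK, NO Monsky 1990**: the sharper form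
through prover-A's `h515`-free door `congruentSilentEvenFiveBSDTwo_of_ordTwo_of_monskyEven`, whose per-member
rank-one hypothesis is discharged by §5 (rank `≥ 1` from the genus point via §4, `≤ 1` from `#Sel₂ = 8`). The
cheapest fact set of route B's kernel enclosure; the display (reduced to `thetaCMDatum`, (D1)–(D7)) is its one
obligation node. CONDITIONAL; nothing asserted. [cite: HeathBrown1994SelmerCongruentII, Appendix (Monsky) p. 41 L20–L36]
[cite: TianYuanZhang2017, Thm. 3.5 and §1 (1.1)] [cite: Miller2011LMS, Def. 1.1 (arXiv:1010.2431 p. 3)] -/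
theorem congruentSilentEvenFiveBSDTwo_of_thetaGenusPointDatum_of_monskyEven
    (hΘ : ∀ p q : ℕ, p.Prime → q.Prime → p % 8 = 5 → q % 4 = 3 → thetaGenusPointDatum p q)
    (hR : redeiReichardt_fourTwoCard_classGroup) (hMe : monsky_card_selmerGroup_two_even) :
    CongruentSilentEvenFiveBSDTwo := by
  refine congruentSilentEvenFiveBSDTwo_of_ordTwo_of_monskyEven hMe (fun p q hp hq hp5 hq4 hj => ?_)
    (congruentSilentEvenFiveOrdTwo_of_thetaGenusPointDatum_of_monskyEven hΘ hR hMe)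
  obtain ⟨D, hD, θ, hθ⟩ := hΘ p q hp hq hp5 hq4
  exact (rank_eq_one_sha_odd_scriptL_of_thetaSpec_of_le_eight hp hq hp5 hq4 D hD θ hθ
    (odd_genusClassNumber_genusField_two_mul_five_mul_of_jacobiSym_neg hR hp hq hp5 hq4 hj)
    (card_selmerGroup_two_two_mul_five_mul hMe hp hq hp5 hq4 hj).le).1

end Summit.BirchSwinnertonDyer.Rank1Residual.P2

end
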